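import Mathlib.Topology.Algebra.Module.FiniteDimension
import Mathlib.Analysis.Calculus.ContDiff.Comp
import Literature.Analysis.Calculus.ExpLocalLieSubalgebra
import Literature.NumberTheory.Automorphic.ArchimedeanCalculus
import HarnessLib

/-!
# Lie derivatives of archimedean-smooth functions are archimedean-smooth
(discharge of the named fact `isArchSmooth_lieDeriv` of `ArchimedeanCalculus`, general `𝔤`)

Topic `NumberTheory/Automorphic`. Let `H : RealMatrixGroup A N` be a linear real group over a
finite-dimensional coefficient algebra `A`, with Lie algebra `𝔤 = H.lie ≤ 𝔤𝔩(N, A)` — an arbitrary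
real Lie subalgebra with `exp (tX) ∈ H` for `X ∈ 𝔤` and `Ad H`-stable, NOT assumed to be all of
`Lie(H)` nor all of `𝔤𝔩(N, A)` — and let `ι : H → G` be a homomorphism into a group. If `φ : G → ℂ`
is smooth in the archimedean variable (`IsArchSmooth ι φ`: `Y ↦ φ (g ι(exp Y))` is `C^∞` on `𝔤` for
every `g`), then so is every Lie derivative `X φ = d/dt φ (· ι(exp tX))|_{t=0}`, `X ∈ 𝔤`
(Borel–Jacquet 1979, §1.5: `U(𝔤)` acts on smooth functions by right-invariant differential
operators; Wallach, *Real Reductive Groups I*, §1.6.2):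

* `isArchSmooth_lieDeriv_of_isArchSmooth` — the statement above;
* `isArchSmooth_lieDeriv_holds` — the named fact `isArchSmooth_lieDeriv` of `ArchimedeanCalculus`
  (the case `H.lie = ⊤` was `ArchimedeanLieDerivSmooth.isArchSmooth_lieDeriv_holds_of_lie_eq_top`).

Proof (exponential charts ALONG `𝔤`): fix `g` and `Y₀ ∈ 𝔤`. For `(Y, t)` near `(Y₀, 0)`,
`exp Y · exp (tX) = exp Y₀ · exp (L(Y, t))` with `L(Y, t) = log (exp(-Y₀) exp(Y) exp(tX))`, `log`
the smooth local inverse of `exp` at `0`; the point is that `L(Y, t) ∈ 𝔤`. This is the local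
Lie-subgroup property of `exp 𝔤`, obtained here without Baker–Campbell–Hausdorff from
`Literature.Analysis.Calculus.exists_isOpen_forall_localLog_mem`: the path
`γ(s) = exp(-sY₀) exp(sY) exp(stX)` joins `1` to `exp(-Y₀) exp(Y) exp(tX)`, stays near `1`
uniformly in `s ∈ [0, 1]` for `(Y, t)` near `(Y₀, 0)` (tube lemma), and has logarithmic derivative
`γ⁻¹γ' = Ad(e^{-stX} e^{-sY})(-Y₀) + Ad(e^{-stX})(Y) + tX ∈ 𝔤` (`Ad H`-stability of `𝔤`), so
`log γ(1) ∈ 𝔤`. Hence `(Y, t) ↦ φ (g ι(exp Y) ι(exp tX)) = Φ_{g ι(exp Y₀)} (q L(Y, t))` is `C^∞`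
near `(Y₀, 0)` (`Φ_{g'} = (Z ↦ φ (g' ι(exp Z)))` smooth on `𝔤` by hypothesis, `q` a continuous
linear retraction onto the finite-dimensional `𝔤`), and `Y ↦ (X φ)(g ι(exp Y)) = ∂_t|₀` of it is
`C^∞` near `Y₀` (`ContDiffAt.fderiv`). Everything here is proved.

## References

* A. Borel, H. Jacquet, *Automorphic forms and automorphic representations*, Proc. Sympos. Pure
  Math. 33 (1979), part 1, §1.5 [BorelJacquet1979].
* N. R. Wallach, *Real Reductive Groups I* (1988), §1.6.2 [WallachRRG1].
* J. Hilgert, K.-H. Neeb, *Structure and Geometry of Lie Groups* (2012), §9.3–9.4 (integral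
  subgroups of linear Lie groups); A. W. Knapp, *Lie Groups Beyond an Introduction* (2002),
  0.§2–§3, I.§10 [Knapp2002].
-/

noncomputable section

open scoped MatrixGroups Matrix ContDiff Topology
open Filter Set Literature.Analysis.Calculus

namespace Literature.NumberTheory.Automorphic

variable {A : Type*} [NormedCommRing A] [NormedAlgebra ℝ A] [NormedAlgebra ℚ A] [CompleteSpace A]
  [StarRing A] {N : Type*} [Fintype N] [DecidableEq N] {H : RealMatrixGroup A N}
  {G : Type*} [Group G] (ι : H.carrier →* G)

-- As in `ArchimedeanLieDerivSmooth`: the scoped `L∞`-operator normed ring structure on matrices is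
-- only reducibly-defeq to the Pi uniformity, so `CompleteSpace (Matrix N N A)` and the analytic facts
-- about `exp` need this setting.
set_option backward.isDefEq.respectTransparency false in
open scoped Matrix.Norms.Operator in
/-- **Lie derivatives preserve archimedean smoothness.** For a linear real group `H` over a
finite-dimensional `A` with (any) Lie algebra `𝔤 = H.lie`, a homomorphism `ι : H → G`, and `φ`
smooth in the archimedean variable, `X φ` is smooth in the archimedean variable for every
`X ∈ 𝔤`: near `(Y₀, 0)`, `φ (g ι(exp Y) ι(exp tX)) = Φ (log (exp(-Y₀) exp Y exp tX))` with
`Φ = (Z ↦ φ (g ι(exp Y₀) ι(exp Z)))` smooth on `𝔤` and `log (exp(-Y₀) exp Y exp tX) ∈ 𝔤` by the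
path form of the local Lie-subgroup property of `exp 𝔤`
(`Literature.Analysis.Calculus.exists_isOpen_forall_localLog_mem`), so `Y ↦ (X φ)(g ι(exp Y))`
is the `t`-derivative at `0` of a function smooth in `(Y, t)`.
Borel–Jacquet 1979, §1.5; Wallach, *Real Reductive Groups I*, §1.6.2. [cite: BorelJacquet1979, §1.5] -/
theorem isArchSmooth_lieDeriv_of_isArchSmooth [FiniteDimensional ℝ A] (X : H.lie) {φ : G → ℂ}
    (hφ : IsArchSmooth ι φ) : IsArchSmooth ι (lieDeriv ι X φ) := by
  -- Mathlib idiom (Mathlib/Algebra/Lie/OfAssociative.lean): the commutator Lie ring on matrices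
  letI : LieRing (Matrix N N A) := LieRing.ofAssociativeRing
  -- the Lie algebra as a real subspace of `𝔤𝔩(N, A)`, and the exponential `𝔤 → H`
  set 𝔤 : Submodule ℝ (Matrix N N A) := H.lie.toSubmodule with h𝔤
  let E : 𝔤 → H.carrier := fun Y => H.expMem ⟨Y, Y.2⟩
  -- (a) `𝔤` is complemented (finite dimension): a continuous linear retraction `q`
  have h𝔤c : 𝔤.ClosedComplemented :=
    Submodule.ClosedComplemented.of_finiteDimensional_quotient
      (Submodule.closed_of_finiteDimensional _)
  obtain ⟨q, hq⟩ := h𝔤c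
  -- (b) `𝔤` is `Ad (exp 𝔤)`-stable
  have hAd : ∀ c ∈ 𝔤, ∀ Z ∈ 𝔤, NormedSpace.exp c * Z * NormedSpace.exp (-c) ∈ 𝔤 :=
      fun c hc Z hZ => by
    have hg : expGL c ∈ H.carrier := by simpa using H.expGL_smul_mem c hc 1
    have h := H.conj_mem_lie (expGL c) hg Z hZ
    rw [← expGL_neg] at h
    exact h
  have hAd' : ∀ c ∈ 𝔤, ∀ Z ∈ 𝔤, NormedSpace.exp (-c) * Z * NormedSpace.exp c ∈ 𝔤 :=
      fun c hc Z hZ => by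
    simpa using hAd (-c) (𝔤.neg_mem hc) Z hZ
  -- (c) the neighbourhood `V` of `1` charted by `log` along `𝔤` (path lemma)
  obtain ⟨V, hVopen, hV1, hVlog, hVpath⟩ := exists_isOpen_forall_localLog_mem ⟨q, hq⟩ hAd
  -- analytic facts about `exp` and `log`
  have hexp : ContDiff ℝ ∞ (NormedSpace.exp : Matrix N N A → Matrix N N A) := contDiff_exp
  have hexpc : Continuous (NormedSpace.exp : Matrix N N A → Matrix N N A) := hexp.continuous
  set log : Matrix N N A → Matrix N N A := localLog with hlog_def
  have hlog : ContDiffAt ℝ ∞ log 1 := contDiffAt_localLog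
  intro g
  refine contDiff_iff_contDiffAt.2 fun Y₀ => ?_
  -- the two-variable function `(Y, t) ↦ φ (g ι(exp Y) ι(exp tX))`
  set f2 : 𝔤 × ℝ → ℂ := fun p => φ (g * ι (E p.1) * ι (H.expMem (p.2 • X))) with hf2_def
  -- the product `P (Y, t) = exp(-Y₀) exp(Y) exp(tX)` and the paths `γ_{(Y, t)}` from `1` to it
  set P : 𝔤 × ℝ → Matrix N N A := fun p =>
    NormedSpace.exp (-(Y₀ : Matrix N N A)) *
      (NormedSpace.exp (p.1 : Matrix N N A) * NormedSpace.exp (p.2 • (X : Matrix N N A)))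
    with hP_def
  have hP : ContDiff ℝ ∞ P :=
    contDiff_const.mul (((hexp.comp 𝔤.subtypeL.contDiff).comp contDiff_fst).mul
      (hexp.comp (contDiff_snd.smul contDiff_const)))
  have hP0 : P (Y₀, 0) = 1 := by
    simp only [hP_def, zero_smul, NormedSpace.exp_zero, mul_one]
    exact exp_neg_mul_exp _
  set γ : 𝔤 × ℝ → ℝ → Matrix N N A := fun p s =>
    NormedSpace.exp (s • (-(Y₀ : Matrix N N A))) *
      (NormedSpace.exp (s • (p.1 : Matrix N N A)) *
        NormedSpace.exp (s • (p.2 • (X : Matrix N N A)))) with hγ_def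
  set ξ : 𝔤 × ℝ → ℝ → Matrix N N A := fun p s =>
    NormedSpace.exp (-(s • (p.2 • (X : Matrix N N A)))) *
          (NormedSpace.exp (-(s • (p.1 : Matrix N N A))) * (-(Y₀ : Matrix N N A)) *
            NormedSpace.exp (s • (p.1 : Matrix N N A))) *
        NormedSpace.exp (s • (p.2 • (X : Matrix N N A))) +
      (NormedSpace.exp (-(s • (p.2 • (X : Matrix N N A)))) * (p.1 : Matrix N N A) *
          NormedSpace.exp (s • (p.2 • (X : Matrix N N A))) +
        p.2 • (X : Matrix N N A)) with hξ_def
  have hγ0 : ∀ p, γ p 0 = 1 := fun p => by simp [hγ_def]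
  have hγ1 : ∀ p, γ p 1 = P p := fun p => by simp [hγ_def, hP_def]
  have hγ00 : ∀ s : ℝ, γ (Y₀, 0) s = 1 := fun s => by
    simp [hγ_def, smul_neg, exp_neg_mul_exp]
  -- `γ' = γ ξ`
  have hγd : ∀ p s, HasDerivAt (γ p) (γ p s * ξ p s) s := fun p s => by
    simp only [hγ_def, hξ_def]
    set a₁ : Matrix N N A := -(Y₀ : Matrix N N A) with ha₁
    set a₂ : Matrix N N A := (p.1 : Matrix N N A) with ha₂
    set a₃ : Matrix N N A := p.2 • (X : Matrix N N A) with ha₃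
    have h := (hasDerivAt_exp_smul_const (𝕂 := ℝ) a₁ s).mul
      ((hasDerivAt_exp_smul_const (𝕂 := ℝ) a₂ s).mul (hasDerivAt_exp_smul_const (𝕂 := ℝ) a₃ s))
    refine h.congr_deriv ?_
    have c₂ : NormedSpace.exp (s • a₂) * NormedSpace.exp (-(s • a₂)) = 1 := exp_mul_exp_neg _
    have c₃ : NormedSpace.exp (s • a₃) * NormedSpace.exp (-(s • a₃)) = 1 := exp_mul_exp_neg _
    have r1 : NormedSpace.exp (s • a₁) * (NormedSpace.exp (s • a₂) * NormedSpace.exp (s • a₃)) *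
        (NormedSpace.exp (-(s • a₃)) * (NormedSpace.exp (-(s • a₂)) * a₁ *
          NormedSpace.exp (s • a₂)) * NormedSpace.exp (s • a₃)) =
        NormedSpace.exp (s • a₁) * a₁ * (NormedSpace.exp (s • a₂) * NormedSpace.exp (s • a₃)) := by
      simp only [mul_assoc]
      rw [← mul_assoc (NormedSpace.exp (s • a₃)) (NormedSpace.exp (-(s • a₃))), c₃, one_mul,
        ← mul_assoc (NormedSpace.exp (s • a₂)) (NormedSpace.exp (-(s • a₂))), c₂, one_mul]
    have r2 : NormedSpace.exp (s • a₁) * (NormedSpace.exp (s • a₂) * NormedSpace.exp (s • a₃)) *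
        (NormedSpace.exp (-(s • a₃)) * a₂ * NormedSpace.exp (s • a₃)) =
        NormedSpace.exp (s • a₁) * (NormedSpace.exp (s • a₂) * a₂ * NormedSpace.exp (s • a₃)) := by
      simp only [mul_assoc]
      rw [← mul_assoc (NormedSpace.exp (s • a₃)) (NormedSpace.exp (-(s • a₃))), c₃, one_mul]
    simp only [mul_add, Pi.mul_apply]
    rw [r1, r2]
    noncomm_ring
  -- `ξ ∈ 𝔤`
  have hξmem : ∀ p s, ξ p s ∈ 𝔤 := fun p s => by
    have m3 : p.2 • (X : Matrix N N A) ∈ 𝔤 := 𝔤.smul_mem _ X.2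
    have m2 : s • (p.2 • (X : Matrix N N A)) ∈ 𝔤 := 𝔤.smul_mem _ m3
    have m1 : s • (p.1 : Matrix N N A) ∈ 𝔤 := 𝔤.smul_mem _ p.1.2
    have mY : -(Y₀ : Matrix N N A) ∈ 𝔤 := 𝔤.neg_mem Y₀.2
    exact 𝔤.add_mem (hAd' _ m2 _ (hAd' _ m1 _ mY)) (𝔤.add_mem (hAd' _ m2 _ p.1.2) m3)
  -- `ξ` is continuous, hence bounded on `[0, 1]`
  have hξB : ∀ p, ∃ B, ∀ s ∈ Icc (0 : ℝ) 1, ‖ξ p s‖ ≤ B := fun p => by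
    have hc : Continuous (ξ p) := by
      simp only [hξ_def]
      fun_prop
    exact isCompact_Icc.exists_bound_of_continuousOn hc.continuousOn
  -- for `p` near `(Y₀, 0)` the whole path `γ_p` stays in `V` (tube lemma)
  have hnear : ∀ᶠ p in 𝓝 (Y₀, (0 : ℝ)), ∀ s ∈ Icc (0 : ℝ) 1, γ p s ∈ V := by
    have hΓ : Continuous fun z : (𝔤 × ℝ) × ℝ => γ z.1 z.2 := by
      simp only [hγ_def]
      fun_prop
    refine isCompact_Icc.eventually_forall_of_forall_eventually fun s _ => ?_
    refine (hΓ.continuousAt (x := ((Y₀, (0 : ℝ)), s))).preimage_mem_nhds (hVopen.mem_nhds ?_)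
    show γ (Y₀, 0) s ∈ V
    rw [hγ00 s]
    exact hV1
  -- hence `log (P p) ∈ 𝔤` and `exp (log (P p)) = P p` near `(Y₀, 0)`
  have hmem : ∀ᶠ p in 𝓝 (Y₀, (0 : ℝ)), log (P p) ∈ 𝔤 ∧ NormedSpace.exp (log (P p)) = P p := by
    filter_upwards [hnear] with p hp
    obtain ⟨B, hB⟩ := hξB p
    have h1 : log (γ p 1) ∈ 𝔤 :=
      hVpath (γ p) (ξ p) B (hγ0 p) hp (fun s _ => hγd p s) (fun s _ => hξmem p s) hB 1
        (right_mem_Icc.2 zero_le_one)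
    have h2 : γ p 1 ∈ V := hp 1 (right_mem_Icc.2 zero_le_one)
    rw [hγ1] at h1 h2
    exact ⟨h1, hVlog _ h2⟩
  -- Step A: `f2` is smooth at `(Y₀, 0)`, through the exponential chart at `exp Y₀` ALONG `𝔤`
  set W : 𝔤 × ℝ → 𝔤 := fun p => q (log (P p)) with hW_def
  have hW : ContDiffAt ℝ ∞ W (Y₀, 0) := by
    have h1 : ContDiffAt ℝ ∞ (fun p : 𝔤 × ℝ => log (P p)) (Y₀, 0) := by
      refine ContDiffAt.comp (Y₀, 0) ?_ hP.contDiffAt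
      rw [hP0]
      exact hlog
    exact q.contDiff.contDiffAt.comp (Y₀, 0) h1
  set Gf : 𝔤 × ℝ → ℂ := fun p => φ (g * ι (E Y₀) * ι (E (W p))) with hGf_def
  have hGf : ContDiffAt ℝ ∞ Gf (Y₀, 0) := (hφ (g * ι (E Y₀))).contDiffAt.comp (Y₀, 0) hW
  have heq : f2 =ᶠ[𝓝 (Y₀, 0)] Gf := by
    filter_upwards [hmem] with p hp
    obtain ⟨hp𝔤, hpexp⟩ := hp
    have hWq : W p = ⟨log (P p), hp𝔤⟩ := hq ⟨log (P p), hp𝔤⟩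
    have key : E p.1 * H.expMem (p.2 • X) = E Y₀ * E (W p) := by
      rw [hWq]
      refine Subtype.ext (Units.ext ?_)
      change NormedSpace.exp (p.1 : Matrix N N A) *
          NormedSpace.exp (((p.2 • X : H.lie) : Matrix N N A)) =
        NormedSpace.exp (Y₀ : Matrix N N A) * NormedSpace.exp (log (P p))
      rw [hpexp, hP_def]
      dsimp only
      rw [← mul_assoc, exp_mul_exp_neg, one_mul]
      rfl
    simp only [hf2_def, hGf_def]
    rw [mul_assoc, ← map_mul, mul_assoc, ← map_mul, key]
  have hA : ContDiffAt ℝ ∞ f2 (Y₀, 0) := hGf.congr_of_eventuallyEq heq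
  -- Step B: `Y ↦ ∂_t|₀ f2 (Y, t)` is smooth at `Y₀`
  have hB : ContDiffAt ℝ ∞ (fun M : 𝔤 => fderiv ℝ (fun t : ℝ => f2 (M, t)) 0) Y₀ := by
    have hunc : (Function.uncurry fun (M : 𝔤) (t : ℝ) => f2 (M, t)) = f2 := by
      funext p; rfl
    refine ContDiffAt.fderiv (𝕜 := ℝ) (n := ∞) (m := ∞) (f := fun M t => f2 (M, t))
      (g := fun _ => (0 : ℝ)) ?_ contDiffAt_const (le_of_eq rfl)
    rw [hunc]
    exact hA
  have hB' : ContDiffAt ℝ ∞ (fun M : 𝔤 => fderiv ℝ (fun t : ℝ => f2 (M, t)) 0 (1 : ℝ)) Y₀ :=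
    hB.clm_apply contDiffAt_const
  -- `(X φ)(g ι(exp Y)) = ∂_t|₀ f2 (Y, t)` by definition of the Lie derivative
  have hFeq : (fun M : 𝔤 => lieDeriv ι X φ (g * ι (E M))) =
      fun M => fderiv ℝ (fun t : ℝ => f2 (M, t)) 0 (1 : ℝ) := by
    funext M
    rw [fderiv_apply_one_eq_deriv]
    rfl
  show ContDiffAt ℝ ∞ (fun M : 𝔤 => lieDeriv ι X φ (g * ι (E M))) Y₀
  rw [hFeq]
  exact hB'

variable {ι}

/-- **Discharge of the named fact `isArchSmooth_lieDeriv`** of `ArchimedeanCalculus`: for every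
linear real group `H` over a finite-dimensional coefficient algebra and every homomorphism
`ι : H → G`, Lie derivatives of archimedean-smooth functions on `G` are archimedean-smooth.
Borel–Jacquet 1979, §1.5. [cite: BorelJacquet1979, §1.5] -/
theorem isArchSmooth_lieDeriv_holds : isArchSmooth_lieDeriv (ι := ι) :=
  fun X _ hφ => isArchSmooth_lieDeriv_of_isArchSmooth ι X hφ

end Literature.NumberTheory.Automorphic
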